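import Literature.NumberTheory.ComplexMultiplication.CMLatticeTraceDualIndex
import Literature.NumberTheory.ComplexMultiplication.CMOrderIdealGeneratorsCount
import HarnessLib

/-!
# The Cohen–Macaulay type of an order is bounded by the degree minus one (MARSEGLIA 2024 PROPOSITION 4.9 =
# MAIN THEOREM 1 (3)), via PROPOSITION 3.5 in dimension form `type_𝔭(𝔯) + 1 = dim_{𝔯/𝔭} (𝔭:𝔭)/𝔭(𝔭:𝔭)`

Family `hodge`, lane `lit-hodgefound` (Track 2 foundations library; seat p15, row g27-#5), topic
`Literature/NumberTheory/ComplexMultiplication`, namespaces `Literature.NumberTheory.ComplexMultiplication.NumberRing`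
(§1, any domain) and `…CMTypeLattice` (§§2–3: the order `𝔯 = endOrder (M_μ)` of a number field `K` of degree
`#ι = [K:ℚ]`, its trace dual `T = 𝔯ᵗ` with `↑T = traceDual ℤ ℚ ↑1`, the local type
`type_𝔭(𝔯) = dim_{𝔯/𝔭} 𝔯ᵗ/𝔭𝔯ᵗ = finrank (𝔯 ⧸ 𝔭) (↥↑T ⧸ 𝔭 • ⊤)` of `CMOrderCohenMacaulayTypeOne`, the multiplicator ring
`(𝔭:𝔭) = ↑𝔭/↑𝔭`).  THEOREMS ONLY: no definition, no instance, no named fact (net Literature debt `0`).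

## Source, VERBATIM

S. Marseglia, *Cohen-Macaulay type of orders, generators and ideal classes*, J. Algebra 658 (2024) 247–276
[Marseglia2024CMType] (arXiv:2206.03758): chunk p0009, "Proposition 3.5. Let `𝔭` be a non-invertible prime of `S`.
Then `type_𝔭(S) + 1 = dim_{S/𝔭} (𝔭:𝔭)/𝔭`"; chunk p0011, "Proposition 4.9. Assume that `dim_Q(K) > 1`. Then the
type of an order in `K` is bounded by `dim_Q(K) − 1`. Moreover, this bound is attained: for any prime `p` of `Z`
the order `T = Z + p𝒪_K` satisfies `type(T) = dim_Q(K) − 1`. Proof. Pick `S` any order in `K`. If `S` is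
Gorenstein then `type(S) = 1` by Proposition 3.4. So we assume that `S` is not Gorenstein. By definition, there
exists a prime `𝔭` of `S` such that `type_𝔭(S) = type(S)`. By Proposition 3.3, the prime `𝔭` is not invertible.
Combining Proposition 3.5 and Lemma 4.2 we obtain `type_𝔭(S) = gens_{S_𝔭}((𝔭:𝔭)_𝔭) − 1`. […]
`(𝔭:𝔭) ⊗_S Ŝ_𝔭` is a free `Ẑ_p`-module of rank `≤ dim_Q(K)`. In particular
`gens_{Ŝ_𝔭}((𝔭:𝔭) ⊗_S Ŝ_𝔭) ≤ dim_Q(K)`. We conclude that `type_𝔭(S) ≤ dim_Q(K) − 1`, as required."; and chunk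
p0003, Main Theorem 1 (3): "Assume that `dim_Q(K) > 1`. Then the type of an order in `K` is bounded by
`dim_Q(K) − 1`."

## What is formalised

* §1 `NumberRing.mul_div_self_eq_self`: `I·(I:I) = I` (so `𝔭(𝔭:𝔭) = 𝔭`).
* §2 **PROPOSITION 3.5 in dimension form, `CMTypeLattice.finrank_traceDual_quotient_add_one_eq`:
  `type_𝔭(𝔯) + 1 = dim_{𝔯/𝔭} (𝔭:𝔭)/𝔭`** at a non-invertible maximal `𝔭` — with `(𝔭:𝔭)/𝔭 = (𝔭:𝔭)/𝔭(𝔭:𝔭)`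
  presented as `↥↑(↑𝔭/↑𝔭) ⧸ 𝔭 • ⊤` (§1), from the cardinality form of `CMLatticeTraceDualIndex` (`#((𝔭:𝔭)/𝔭) =
  #(𝔯/𝔭)^{type_𝔭+1}`) and `#V = #(𝔯/𝔭)^{dim V}`; plumbing
  `natCard_quotient_div_self_comap_coeIdeal_eq_natCard_quotient_smul_top`, `one_lt_natCard_quotient`.
* §3 **PROPOSITION 4.9 / MAIN THEOREM 1 (3), the bound: `finrank_traceDual_quotient_le_card_sub_one`,
  `type_𝔭(𝔯) ≤ [K:ℚ] − 1` for every nonzero prime `𝔭` of `𝔯 = endOrder (M_μ)` when `[K:ℚ] ≥ 2`** — at an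
  invertible prime `type_𝔭 = 1` (Prop. 3.3, `CMOrderCohenMacaulayTypeOne`); at a non-invertible one
  `type_𝔭 + 1 = dim (𝔭:𝔭)/𝔭(𝔭:𝔭) = gens_{𝔯_𝔭}((𝔭:𝔭)_𝔭) ≤ [K:ℚ]` (`CMOrderIdealGeneratorsCount.finrank_quotient_smul_top_le_card`,
  replacing the completion argument of the printed proof by the `ℤ`-basis bound of the same quantity).
  NOT formalised: the attainment `type(ℤ + p𝒪_K) = [K:ℚ] − 1` (`TODO`).
-/

noncomputable section

open scoped nonZeroDivisors NumberField
open NumberField Module FractionalIdeal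
open Submodule (traceDual)

namespace Literature.NumberTheory.ComplexMultiplication

namespace NumberRing

variable {R : Type*} [CommRing R] [IsDomain R] {K : Type*} [Field K] [Algebra R K] [IsFractionRing R K]

/-- **`I·(I:I) = I`** for every nonzero fractional ideal (`⊆` by definition of the colon, `⊇` as `1 ∈ (I:I)`); in
particular `𝔭(𝔭:𝔭) = 𝔭`, so that `(𝔭:𝔭)/𝔭` IS the `S/𝔭`-space `(𝔭:𝔭)/𝔭(𝔭:𝔭)` of Lemma 4.2.
[cite: Marseglia2024CMType, §4 Prop. 4.9 (proof: «`type_𝔭(S) = gens_{S_𝔭}((𝔭:𝔭)_𝔭) − 1`»), p. 11] -/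
theorem mul_div_self_eq_self {I : FractionalIdeal R⁰ K} (hI : I ≠ 0) : I * (I / I) = I := by
  refine le_antisymm ?_ ?_
  · rw [mul_comm]
    exact (le_div_iff_mul_le hI).1 le_rfl
  · conv_lhs => rw [← mul_one I]
    exact mul_le_mul_right ((le_div_iff_mul_le hI).2 (by rw [one_mul])) I

end NumberRing

namespace CMTypeLattice

variable {K : Type} [Field K] [NumberField K]
variable {ι : Type} [Fintype ι] [DecidableEq ι] (μ : Basis ι ℚ K) [Nonempty ι]
variable [IsFractionRing (endOrder (Algebra.leftMulMatrix μ)) K]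

/-! ## §2 PROPOSITION 3.5 in dimension form: `type_𝔭(𝔯) + 1 = dim_{𝔯/𝔭} (𝔭:𝔭)/𝔭` -/

omit [Nonempty ι] in
/-- Plumbing: `#((𝔭:𝔭)/𝔭) = #((𝔭:𝔭)/𝔭(𝔭:𝔭))`, the latter as the `𝔯/𝔭`-space `↥(𝔭:𝔭) ⧸ 𝔭 • ⊤` (§1: `𝔭(𝔭:𝔭) = 𝔭`).
[cite: Marseglia2024CMType, §4 Prop. 4.9 (proof), p. 11] -/
theorem natCard_quotient_div_self_comap_coeIdeal_eq_natCard_quotient_smul_top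
    (𝔭 : Ideal (endOrder (Algebra.leftMulMatrix μ))) (h0 : 𝔭 ≠ ⊥) :
    Nat.card (↥(((𝔭 : FractionalIdeal (endOrder (Algebra.leftMulMatrix μ))⁰ K) / 𝔭 :
        FractionalIdeal (endOrder (Algebra.leftMulMatrix μ))⁰ K) : Submodule (endOrder (Algebra.leftMulMatrix μ)) K) ⧸
      ((𝔭 : FractionalIdeal (endOrder (Algebra.leftMulMatrix μ))⁰ K) :
          Submodule (endOrder (Algebra.leftMulMatrix μ)) K).comap
        (((𝔭 : FractionalIdeal (endOrder (Algebra.leftMulMatrix μ))⁰ K) / 𝔭 :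
          FractionalIdeal (endOrder (Algebra.leftMulMatrix μ))⁰ K) :
            Submodule (endOrder (Algebra.leftMulMatrix μ)) K).subtype) =
      Nat.card (↥(((𝔭 : FractionalIdeal (endOrder (Algebra.leftMulMatrix μ))⁰ K) / 𝔭 :
        FractionalIdeal (endOrder (Algebra.leftMulMatrix μ))⁰ K) : Submodule (endOrder (Algebra.leftMulMatrix μ)) K) ⧸
        (𝔭 • ⊤ : Submodule (endOrder (Algebra.leftMulMatrix μ))
          (((𝔭 : FractionalIdeal (endOrder (Algebra.leftMulMatrix μ))⁰ K) / 𝔭 :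
            FractionalIdeal (endOrder (Algebra.leftMulMatrix μ))⁰ K) :
              Submodule (endOrder (Algebra.leftMulMatrix μ)) K))) := by
  have hP0 : (𝔭 : FractionalIdeal (endOrder (Algebra.leftMulMatrix μ))⁰ K) ≠ 0 := coeIdeal_ne_zero.2 h0
  rw [← natCard_quotient_comap_coeIdeal_mul μ 𝔭]
  exact natCard_quotient_comap_congr rfl (congr_arg _ (NumberRing.mul_div_self_eq_self hP0).symm)

omit [IsFractionRing (endOrder (Algebra.leftMulMatrix μ)) K] in
/-- Plumbing: the residue field `𝔯/𝔭` of a nonzero proper ideal has at least two elements.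
[cite: Marseglia2024CMType, §2.4 Lemma 2.7 («`S/𝔭` is a finite field»), p. 6] -/
theorem one_lt_natCard_quotient {𝔭 : Ideal (endOrder (Algebra.leftMulMatrix μ))} (h0 : 𝔭 ≠ ⊥) (h1 : 𝔭 ≠ ⊤) :
    1 < Nat.card (endOrder (Algebra.leftMulMatrix μ) ⧸ 𝔭) := by
  haveI := finite_quotient_endOrder (Algebra.leftMulMatrix μ) h0
  haveI : Nontrivial (endOrder (Algebra.leftMulMatrix μ) ⧸ 𝔭) := Ideal.Quotient.nontrivial_iff.2 h1
  exact Finite.one_lt_card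

/-- **MARSEGLIA 2024 PROPOSITION 3.5 (dimension form): `type_𝔭(𝔯) + 1 = dim_{𝔯/𝔭} (𝔭:𝔭)/𝔭`** at a non-invertible
maximal ideal `𝔭` of the order `𝔯 = endOrder (M_μ)` — `(𝔭:𝔭)/𝔭 = (𝔭:𝔭)/𝔭(𝔭:𝔭)` as an `𝔯/𝔭`-space; from the
cardinality form `#((𝔭:𝔭)/𝔭) = #(𝔯/𝔭)^{type_𝔭(𝔯)+1}` (`CMLatticeTraceDualIndex`). [cite: Marseglia2024CMType,
§3 Prop. 3.5, p. 9] -/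
theorem finrank_traceDual_quotient_add_one_eq {T : FractionalIdeal (endOrder (Algebra.leftMulMatrix μ))⁰ K}
    (hT : (T : Submodule (endOrder (Algebra.leftMulMatrix μ)) K) =
      traceDual ℤ ℚ ((1 : FractionalIdeal (endOrder (Algebra.leftMulMatrix μ))⁰ K) :
        Submodule (endOrder (Algebra.leftMulMatrix μ)) K))
    (𝔭 : Ideal (endOrder (Algebra.leftMulMatrix μ))) [h𝔭 : 𝔭.IsMaximal]
    (h : ¬ IsUnit (𝔭 : FractionalIdeal (endOrder (Algebra.leftMulMatrix μ))⁰ K)) :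
    Module.finrank (endOrder (Algebra.leftMulMatrix μ) ⧸ 𝔭)
        ((T : Submodule (endOrder (Algebra.leftMulMatrix μ)) K) ⧸
          (𝔭 • ⊤ : Submodule (endOrder (Algebra.leftMulMatrix μ))
            (T : Submodule (endOrder (Algebra.leftMulMatrix μ)) K))) + 1 =
      Module.finrank (endOrder (Algebra.leftMulMatrix μ) ⧸ 𝔭)
        ((((𝔭 : FractionalIdeal (endOrder (Algebra.leftMulMatrix μ))⁰ K) / 𝔭 :
          FractionalIdeal (endOrder (Algebra.leftMulMatrix μ))⁰ K) : Submodule (endOrder (Algebra.leftMulMatrix μ)) K) ⧸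
          (𝔭 • ⊤ : Submodule (endOrder (Algebra.leftMulMatrix μ))
            (((𝔭 : FractionalIdeal (endOrder (Algebra.leftMulMatrix μ))⁰ K) / 𝔭 :
              FractionalIdeal (endOrder (Algebra.leftMulMatrix μ))⁰ K) :
                Submodule (endOrder (Algebra.leftMulMatrix μ)) K))) := by
  have h0 : 𝔭 ≠ ⊥ := Ring.ne_bot_of_isMaximal_of_not_isField h𝔭 EndOrder.not_isField
  have key := natCard_quotient_div_self_comap_coeIdeal_eq_pow μ hT 𝔭 h
  rw [natCard_quotient_div_self_comap_coeIdeal_eq_natCard_quotient_smul_top μ 𝔭 h0] at key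
  letI : Field (endOrder (Algebra.leftMulMatrix μ) ⧸ 𝔭) := Ideal.Quotient.field 𝔭
  haveI := CMTypeLattice.isNoetherianRing_endOrder (Algebra.leftMulMatrix μ)
  haveI := NumberRing.finite_quotient_smul_top (K := K) 𝔭
    (fg_of_isNoetherianRing le_rfl (((𝔭 : FractionalIdeal (endOrder (Algebra.leftMulMatrix μ))⁰ K) / 𝔭 :
      FractionalIdeal (endOrder (Algebra.leftMulMatrix μ))⁰ K)) :
      ((((𝔭 : FractionalIdeal (endOrder (Algebra.leftMulMatrix μ))⁰ K) / 𝔭 :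
        FractionalIdeal (endOrder (Algebra.leftMulMatrix μ))⁰ K) :
          Submodule (endOrder (Algebra.leftMulMatrix μ)) K)).FG)
  rw [Module.natCard_eq_pow_finrank (K := endOrder (Algebra.leftMulMatrix μ) ⧸ 𝔭)] at key
  exact (Nat.pow_right_injective (one_lt_natCard_quotient μ h0 h𝔭.ne_top) key).symm

/-! ## §3 PROPOSITION 4.9 / MAIN THEOREM 1 (3): `type_𝔭(𝔯) ≤ [K:ℚ] − 1` -/

/-- **MARSEGLIA 2024 PROPOSITION 4.9 (= MAIN THEOREM 1 (3)), the bound: the local Cohen–Macaulay type of an order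
of a number field of degree `[K:ℚ] = #ι ≥ 2` is at most `[K:ℚ] − 1` at every nonzero prime** (`= 1` at an
invertible prime, Prop. 3.3; at a non-invertible prime `type_𝔭 + 1 = dim (𝔭:𝔭)/𝔭(𝔭:𝔭) = gens_{𝔯_𝔭}((𝔭:𝔭)_𝔭)
≤ [K:ℚ]`). `TODO`: the attainment by `ℤ + p𝒪_K`. [cite: Marseglia2024CMType, §4 Prop. 4.9, p. 11; §1 Main
Theorem 1 (3), p. 3] -/
theorem finrank_traceDual_quotient_le_card_sub_one {T : FractionalIdeal (endOrder (Algebra.leftMulMatrix μ))⁰ K}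
    (hT : (T : Submodule (endOrder (Algebra.leftMulMatrix μ)) K) =
      traceDual ℤ ℚ ((1 : FractionalIdeal (endOrder (Algebra.leftMulMatrix μ))⁰ K) :
        Submodule (endOrder (Algebra.leftMulMatrix μ)) K))
    (h2 : 2 ≤ Fintype.card ι) {𝔭 : Ideal (endOrder (Algebra.leftMulMatrix μ))} [h𝔭 : 𝔭.IsPrime] (h0 : 𝔭 ≠ ⊥) :
    Module.finrank (endOrder (Algebra.leftMulMatrix μ) ⧸ 𝔭)
        ((T : Submodule (endOrder (Algebra.leftMulMatrix μ)) K) ⧸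
          (𝔭 • ⊤ : Submodule (endOrder (Algebra.leftMulMatrix μ))
            (T : Submodule (endOrder (Algebra.leftMulMatrix μ)) K))) ≤ Fintype.card ι - 1 := by
  haveI := isMaximal_of_isPrime_endOrder (Algebra.leftMulMatrix μ) h𝔭 h0
  by_cases hu : IsUnit (𝔭 : FractionalIdeal (endOrder (Algebra.leftMulMatrix μ))⁰ K)
  · rw [finrank_traceDual_quotient_eq_one_of_isUnit_coeIdeal μ hT h0 hu]
    omega
  · have hP0 : (𝔭 : FractionalIdeal (endOrder (Algebra.leftMulMatrix μ))⁰ K) ≠ 0 := coeIdeal_ne_zero.2 h0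
    have hM0 : ((𝔭 : FractionalIdeal (endOrder (Algebra.leftMulMatrix μ))⁰ K) / 𝔭 :
        FractionalIdeal (endOrder (Algebra.leftMulMatrix μ))⁰ K) ≠ 0 := by
      intro hz
      have h1 : (1 : FractionalIdeal (endOrder (Algebra.leftMulMatrix μ))⁰ K) ≤
          ((𝔭 : FractionalIdeal (endOrder (Algebra.leftMulMatrix μ))⁰ K) / 𝔭 :
            FractionalIdeal (endOrder (Algebra.leftMulMatrix μ))⁰ K) :=
        (le_div_iff_mul_le hP0).2 (by rw [one_mul])
      rw [hz] at h1
      exact one_ne_zero (le_antisymm h1 (by rw [← coeIdeal_bot]; exact coeIdeal_le_one))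
    have h := finrank_traceDual_quotient_add_one_eq μ hT 𝔭 hu
    have hle := finrank_quotient_smul_top_le_card μ hM0 (𝔭 := 𝔭) h0
    omega

end CMTypeLattice

end Literature.NumberTheory.ComplexMultiplication
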